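import Summits.RiemannHypothesis.RiemannHypothesis.Theorems.HandoffDodgerSmallPhi
import Summits.RiemannHypothesis.RiemannHypothesis.Theorems.HandoffDodgerProfileDefs
import HarnessLib

/-!
# HANDOFF — SIXTH SLAB (5): the profile value at `y = 16`, window `α = 47/100` (rh-explicit, W-P(P2) crux 19172 residue, seat prove-2 gen14; ATTEMPT-24 §3)

RH-FREE. HONEST FRAMING: nothing here bears on the truth of RH; part (5) of the discharge of the hypotheses of
`HandoffDodgerExplicitWindowCountingFT.dodger_witness_explicit_window_counting_ft` on the sixth slab `640 ≤ q < 1015` at the constant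
schedule `y = 16`, `α = 47/100`: the profile argument is the CONSTANT `x = (199α/100)²·y² = (0.9353)²·256 = 223.94…`, so ONE partial sum
suffices — `Φ(x) ≥ Φ(223) ≥ Σ_{n ≤ 9} 223ⁿ/(n!(2n)!) ≥ 7960` (**`dodgerPhi_slabSix_ge`**); the per-sub-slab numeric comparison
`2.74·B₂(B₂+0.834)·X < 0.0256·κ₀²·7960²` is then a `norm_num` fact in the assembly. dodger-p2's `HandoffDodgerSlabFivePhi` re-constanted.

References: this track (ATTEMPT-16 §1, ATTEMPT-21 §6, ATTEMPT-23 §2/§7, ATTEMPT-24 §3; HOME/rh-explicit-dodger-p2/DODGER-STAGE2-PLAN.md §2).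
-/

set_option linter.dupNamespace false

noncomputable section

open Real Finset

namespace Summit.RiemannHypothesis.RiemannHypothesis.Theorems.Handoff

/-- `Σ_{n ≤ 9} 223ⁿ/(n!(2n)!) ≥ 7960`. [this track, ATTEMPT-24 §3] -/
theorem profileSum_ge_slabSix :
    (7960 : ℝ) ≤ ∑ n ∈ range 10, (223 : ℝ) ^ n / ((n.factorial : ℝ) * ((2 * n).factorial : ℝ)) := by
  simp only [sum_range_succ, sum_range_zero, Nat.factorial]
  norm_num

/-- **Part (5) of the sixth-slab discharge: the profile value at `y = 16`, `α = 47/100`.**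
`7960 ≤ Φ((199·(47/100)/100)²·16²)` (`Φ = dodgerPhi`). [this track, ATTEMPT-24 §3] -/
theorem dodgerPhi_slabSix_ge : (7960 : ℝ) ≤ dodgerPhi ((199 * (47 / 100 : ℝ) / 100) ^ 2 * 16 ^ 2) := by
  have hS := profileSum_le_of_hasSum (by norm_num : (0 : ℝ) ≤ 223) (summable_dodgerPhiTerm 223).hasSum 10
  have h1 : (7960 : ℝ) ≤ dodgerPhi 223 := profileSum_ge_slabSix.trans hS
  have h2 : dodgerPhi 223 ≤ dodgerPhi ((199 * (47 / 100 : ℝ) / 100) ^ 2 * 16 ^ 2) :=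
    dodgerPhi_le_dodgerPhi (by norm_num) (by norm_num)
  exact h1.trans h2

end Summit.RiemannHypothesis.RiemannHypothesis.Theorems.Handoff

end
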